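import Literature.Analysis.FluidPDE.RusinSverakMinimalData
import Literature.Analysis.FluidPDE.HomSobolevWeakLimits
import Literature.Analysis.FluidPDE.KatoLocalCovariance
import HarnessLib

/-!
# Named facts: finite `T_max` forces a singular point; weak stability of singular points
(Rusin–Šverák 2011, §4 p. 6 and Cor. 4.2) — and the reduction of Cor. 4.3 to them

Grounder/refinement file (D-0014 named facts) for
`Literature.Analysis.FluidPDE.rusin_sverak_minimal_data_compact` (`RusinSverakCompactness.lean`; Rusin–Šverák,
J. Funct. Anal. 260 (2011) 879–891 = arXiv:0911.0500, Cor. 4.3 p. 8, second clause) and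
`Literature.Analysis.FluidPDE.rusin_sverak_minimal_blowup` (`MildSolutions.lean`; Cor. 4.3, first clause).

`RusinSverakCompactnessProofs.lean` and `RusinSverakMinimalData.lean` prove both corollaries from
the single data-level fact `NS.rusin_sverak_weak_limit_blowup` (sentences 2–4 of the printed
proof of Cor. 4.3). This file splits that fact along the printed proof into the two PDE
statements it combines, each now a named fact phrased with the tree's notions only (Kato-class
mild solutions `Fluid.IsMildNSSolutionOn (Ico 0 T)` + `Fluid.ContinuousInLpOn (Ico 0 T) 3`, as
in `NS.kato_local`; backward parabolic cylinders `Fluid.parabolicCylinder`, CKN 1982 §2; and the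
`L^∞` form of "singular point" of CKN 1982 §6 used by `Fluid.IsRegularPoint`):

* `NS.rusin_sverak_singular_point_of_blowup` — **"the only reason for `T_max(u₀) < ∞` can be a
  finite time singularity"** (§3 p. 5, (3.14); §4 pp. 6–7, the paragraph after Thm. 4.1, with
  Prop. 4.1, Thm. 4.1 and Prop. 2.1): a divergence-free `Ḣ^{1/2}` datum without global Kato
  solution has a Kato solution on some `[0, T)` which is essentially unbounded on every
  backward parabolic cylinder `Q_r(T, x_*)` at some point `x_* ∈ ℝ³`;
* `NS.rusin_sverak_weak_limit_of_singular_points` — **Cor. 4.2** (p. 8; from Thm. 4.2,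
  Lemma 4.1, Prop. 2.2, Lemma 2.1, Thm. 4.1): if data `v₀^k`, bounded in `Ḣ^{1/2}`, converge
  weakly to `v₀`, and their Kato solutions live on a common `[0, T)` and are singular at
  `(T, x_k)` with `x_k` bounded, then `T_max(v₀) ≤ T`, in particular `v₀` has no global Kato
  solution;

and **proves** the reduction
`NS.rusin_sverak_weak_limit_blowup_of_singular_points :
  rusin_sverak_singular_point_of_blowup → rusin_sverak_weak_limit_of_singular_points →
  eLpNorm_three_le_eHomSobolevSeminorm_half → rusin_sverak_weak_limit_blowup`
(sentence 2 of the printed proof: normalise each blow-up datum by `λ_k = √T_k`, `x₀^k = -x_*^k`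
so that the singular point moves to `(1, 0)` — `NS.kato_local_normalise`,
`KatoLocalCovariance.lean`; the weak limit is an `L³`, real, divergence-free datum —
`HomSobolev.exists_represents_memLp_three`, `HomSobolev.Represents.exists_real_divFree`,
`HomSobolevWeakLimits.lean`, using the tree's Sobolev-embedding fact
`eLpNorm_three_le_eHomSobolevSeminorm_half` (Bahouri–Chemin–Danchin 2011, Thm. 1.38); then
Cor. 4.2 with `T = 1`, `x_k = 0`), whence
`NS.rusin_sverak_minimal_data_compact_of_singular_points` and
`NS.rusin_sverak_minimal_blowup_of_singular_points`.

State of the DAG below `rusin_sverak_minimal_data_compact` after this file: proved modulo the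
three named facts `rusin_sverak_singular_point_of_blowup` (ε-regularity level),
`rusin_sverak_weak_limit_of_singular_points` (Rusin–Šverák's main new observation, Thm. 4.2 +
Lemma 2.1) and `eLpNorm_three_le_eHomSobolevSeminorm_half` (`FourierSobolevNorm.lean`).

Transcription notes. (1) Rusin–Šverák's `T_max(u₀)` is the maximal time of the Fujita–Kato mild
solution in `Ḣ^{1/2}` (§3); the tree phrases "`T_max = ∞`" as `NS.HasGlobalKatoSolution`
(Kato's class `C([0,∞); L³)`; see its docstring in `MildSolutions.lean`: for `Ḣ^{1/2} ⊂ L³` data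
the Kato and Fujita–Kato solutions coincide and have the same maximal time, Kato 1984 Thm. 4 and
the note there), and accordingly "the mild solution on `[0, T)`, `T ≤ T_max`" as a Kato-class
mild solution on `Ico 0 T` (the class of `NS.kato_local`, unique by `NS.kato_unique`).
(2) Rusin–Šverák call `z₀` a regular point of the Leray solution `u ∈ NS(u₀)` if `u` is Hölder
continuous near `z₀` (§2 p. 4); by Thm. 4.1 the Leray solution *is* the mild solution on
`ℝ³ × [0, T_max)`, so for `z₀ = (x_*, T)` with `T ≤ T_max` regularity at `z₀` forces essential
boundedness of the mild solution on a backward cylinder `Q_r(T, x_*)`, and conversely essential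
boundedness on some `Q_r(T, x_*)` makes `z₀` regular by the ε-regularity criterion Prop. 2.1
(with the pressure split of the proof of Lemma 2.1). The facts below therefore say "singular at
`(T, x_*)`" as "essentially unbounded on every `Q_r(T, x_*)`", which mentions the solution only
below `T`, where it is the (unique) mild solution. (3) Cor. 4.2 is printed for `u₀^k, u₀, u^k`
"as in Thm. 4.2", i.e. with the Leray solutions `u^k` converging in distributions to some `u`;
by Lemma 4.1 a subsequence always does, and the conclusion `T_max(u₀) ≤ T` concerns the data
only, so the hypothesis is dropped here at the price of passing to a subsequence inside the
cited proof. Nothing is asserted; users take `(hN : NS.rusin_sverak_singular_point_of_blowup)`,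
`(hC : NS.rusin_sverak_weak_limit_of_singular_points)`.

## References

* W. Rusin, V. Šverák, *Minimal initial data for potential Navier–Stokes singularities*,
  J. Funct. Anal. 260 (2011) 879–891; arXiv:0911.0500: §2 (Prop. 2.1, Prop. 2.2, Lemma 2.1),
  §3 (p. 5, (3.14)), §4 (pp. 6–8: Thm. 4.1, the paragraph following it, Prop. 4.1, Lemma 4.1,
  Thm. 4.2, Cor. 4.2, Cor. 4.3).
* L. Caffarelli, R. Kohn, L. Nirenberg, CPAM 35 (1982), §2, §6 (parabolic cylinders, regular
  points).
* T. Kato, Math. Z. 187 (1984), Thm. 4 (Kato solutions; coincidence with Fujita–Kato solutions).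
* H. Bahouri, J.-Y. Chemin, R. Danchin, *Fourier Analysis and Nonlinear PDE* (2011), Thm. 1.38.
-/

noncomputable section

open MeasureTheory TopologicalSpace Filter Topology Set Function
open scoped ENNReal NNReal InnerProductSpace

namespace Literature.Analysis.FluidPDE

/-! ## The two named facts -/

/-- NAMED FACT (Rusin–Šverák, J. Funct. Anal. 260 (2011) = arXiv:0911.0500, §4 pp. 6–7 with
§3 p. 5, Prop. 4.1, Thm. 4.1, Prop. 2.1: **a finite maximal time forces a singular point at
`t = T_max`**). In print (p. 6): "Proposition 2.1 can be used to show that the only reason for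
`T_max(u₀) < ∞` can be a finite time singularity. [...] Let us assume that `T = T_max(u₀)` is
finite. [...] for sufficiently large `R > 0`, the assumptions of Proposition 2.1 are satisfied
for our solution `(u,p)` and `Q_{z₀,r}` with `z₀ = (x₀,T)` and `|x₀| > R`. If `u` does not
develop a singularity at time `T` in the ball `B_R` [...] we see by the energy estimate that
`u ∈ L⁴_t Ḣ¹_x(ℝ³ × (0,T))`, which means that `T` was not the maximal time of existence of the
mild solution, a contradiction"; Thm. 4.1 (p. 6): "the mild solution coincides with [the Leray
solution] `u` in `ℝ³ × [0, T_max(u₀))`"; §3 (p. 5): "the mild solutions are smooth in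
`ℝ³ × (0, T_max(u₀))`". Transcription (see the module docstring, notes (1)–(2)): for a weakly
divergence-free `u₀ ∈ L³(ℝ³)` represented in `Ḣ^{1/2}` with no global Kato solution
(`T_max(u₀) < ∞`, unit viscosity, no force) there are `T > 0` (namely `T_max(u₀)`),
`x_* ∈ ℝ³` and a mild solution `u` on `[0, T)` with datum `u₀` in Kato's class `C([0,T); L³)`
(`u(0) = u₀`, measurable on `(0,T) × ℝ³`) which is essentially unbounded on every backward
parabolic cylinder `Q_r(T, x_*) = (T - r², T) × B_r(x_*)` (`Fluid.parabolicCylinder`), i.e.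
`(x_*, T)` is a singular point in the `L^∞` sense of CKN 1982 §6. Users take
`(h : rusin_sverak_singular_point_of_blowup)`.
[cite: RusinSverak2011, §4 pp. 6–7 (paragraph after Thm. 4.1) with Thm. 4.1, Prop. 4.1, Prop. 2.1 (arXiv:0911.0500)] -/
def rusin_sverak_singular_point_of_blowup : Prop :=
  ∀ (u₀ : EuclideanSpace ℝ (Fin 3) → EuclideanSpace ℝ (Fin 3))
    (g : FunctionSpaces.HomSobolev (EuclideanSpace ℝ (Fin 3)) (EuclideanSpace ℂ (Fin 3)) (1 / 2 : ℝ)),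
    MemLp u₀ 3 volume → g.Represents (FunctionSpaces.EuclideanSpace.complexify ∘ u₀) →
    FluidPDE.IsWeaklyDivFree u₀ → ¬ HasGlobalKatoSolution 1 u₀ →
    ∃ T : ℝ, 0 < T ∧ ∃ (xs : EuclideanSpace ℝ (Fin 3))
      (u : ℝ → EuclideanSpace ℝ (Fin 3) → EuclideanSpace ℝ (Fin 3)),
      FluidPDE.IsMildNSSolutionOn (Ico 0 T) 1 0 u₀ u ∧ FluidPDE.ContinuousInLpOn (Ico 0 T) 3 u ∧
      u 0 = u₀ ∧ AEStronglyMeasurable (uncurry u) (volume.restrict (Ioo 0 T ×ˢ univ)) ∧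
      ∀ r : ℝ, 0 < r →
        eLpNorm (uncurry u) ∞ (volume.restrict (FluidPDE.parabolicCylinder r ((T : ℝ), xs))) = ∞

/-- NAMED FACT (Rusin–Šverák, J. Funct. Anal. 260 (2011) = arXiv:0911.0500, **Cor. 4.2**,
p. 8, proved from Thm. 4.2, Lemma 4.1, Prop. 2.2, Lemma 2.1 and Thm. 4.1: **weak stability of
singular points at a fixed time**). In print: "[Thm. 4.2: Let `u₀^k` be a bounded sequence of
initial conditions in `Ḣ^{1/2}` converging weakly in `Ḣ^{1/2}` to `u₀`. Let `u^k ∈ NS(u₀^k)` be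
Leray solutions ...] Corollary 4.2. Let `u₀^k, u₀, u^k` be as in the theorem. Assume that
`T_max(u₀^k) = T < +∞` for each `k` and that the singular points `z_k` of `u^k` at `t = T`
(which exist by Proposition 4.1) stay in a compact subset of `ℝ³ × {T}`. Then `T_max(u₀) ≤ T`."
Transcription (module docstring, notes (1)–(3)): data are weakly divergence-free `L³` fields
`v₀^k` represented by classes `g_k ∈ Ḣ^{1/2}(ℝ³; ℂ³)` with `‖g_k‖` bounded; "`T_max(v₀^k) = T`
with a singular point `(x_k, T)`" is: `v₀^k` has a Kato-class mild solution `v^k` on `[0, T)`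
(so `T ≤ T_max`) which is essentially unbounded on every backward parabolic cylinder
`Q_r(T, x_k)` (so `(x_k, T)` is singular and `T_max ≤ T`); the `x_k` are bounded; `g_k ⇀ g_∞`
weakly in `Ḣ^{1/2}` (`⟪g_k, w⟫ → ⟪g_∞, w⟫` for all `w`); conclusion: every weakly divergence-free
`L³` field `v₀` represented by `g_∞` has no global Kato solution (`T_max(v₀) ≤ T < ∞`). Users
take `(h : rusin_sverak_weak_limit_of_singular_points)`.
[cite: RusinSverak2011, Cor. 4.2 (arXiv:0911.0500 p. 8) with Thm. 4.2, Lemma 4.1, Prop. 2.2, Lemma 2.1, Thm. 4.1] -/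
def rusin_sverak_weak_limit_of_singular_points : Prop :=
  ∀ (T : ℝ), 0 < T →
    ∀ (v₀ : ℕ → EuclideanSpace ℝ (Fin 3) → EuclideanSpace ℝ (Fin 3))
      (g : ℕ → FunctionSpaces.HomSobolev (EuclideanSpace ℝ (Fin 3)) (EuclideanSpace ℂ (Fin 3)) (1 / 2 : ℝ))
      (v : ℕ → ℝ → EuclideanSpace ℝ (Fin 3) → EuclideanSpace ℝ (Fin 3))
      (x : ℕ → EuclideanSpace ℝ (Fin 3)),
    (∀ k, MemLp (v₀ k) 3 volume ∧ (g k).Represents (FunctionSpaces.EuclideanSpace.complexify ∘ v₀ k) ∧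
      FluidPDE.IsWeaklyDivFree (v₀ k)) →
    (∃ R : ℝ, ∀ k, ‖g k‖ ≤ R) →
    (∀ k, FluidPDE.IsMildNSSolutionOn (Ico 0 T) 1 0 (v₀ k) (v k) ∧
      FluidPDE.ContinuousInLpOn (Ico 0 T) 3 (v k) ∧ v k 0 = v₀ k ∧
      AEStronglyMeasurable (uncurry (v k)) (volume.restrict (Ioo 0 T ×ˢ univ))) →
    (∀ k (r : ℝ), 0 < r →
      eLpNorm (uncurry (v k)) ∞ (volume.restrict (FluidPDE.parabolicCylinder r ((T : ℝ), x k))) = ∞) →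
    (∃ ρ : ℝ, ∀ k, ‖x k‖ ≤ ρ) →
    ∀ glim : FunctionSpaces.HomSobolev (EuclideanSpace ℝ (Fin 3)) (EuclideanSpace ℂ (Fin 3)) (1 / 2 : ℝ),
      (∀ w, Tendsto (fun n => ⟪g n, w⟫_ℂ) atTop (𝓝 ⟪glim, w⟫_ℂ)) →
      ∀ vlim : EuclideanSpace ℝ (Fin 3) → EuclideanSpace ℝ (Fin 3), MemLp vlim 3 volume →
        glim.Represents (FunctionSpaces.EuclideanSpace.complexify ∘ vlim) → FluidPDE.IsWeaklyDivFree vlim →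
        ¬ HasGlobalKatoSolution 1 vlim

/-! ## The reduction of the weak-limit blow-up fact -/

/-- **Rusin–Šverák's weak-limit blow-up (`rusin_sverak_weak_limit_blowup`) from "finite `T_max`
forces a singular point" and Cor. 4.2.** This is sentence 2 of the printed proof of Cor. 4.3
(arXiv:0911.0500 p. 8: "Find `λ_k > 0` and `x₀^k` so that the functions given by
`v^k(x) = λ_k u₀^k(λ_k x - x₀^k)` develop their first singularity at time `t = 1` and that
`(x,t) = (0,1)` is a singular point of `v^k`") followed by sentence 4 ("By Corollary 4.2 we know
that `T_max(v₀) ≤ 1`"): for each blow-up datum take `T_k, x_*^k` and the Kato solution from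
`rusin_sverak_singular_point_of_blowup`, put `λ_k = √T_k`, `x₀^k = -x_*^k`; the normalised data
have Kato solutions on `[0, 1)` singular at `(1, 0)` (`kato_local_normalise`) and representing
classes of the same norm (`exists_represents_rescaleData_norm_eq`, `Represents.unique`); a weak
limit `g_∞` of a subsequence is represented by an `L³` field
(`HomSobolev.exists_represents_memLp_three`, from the Sobolev embedding `Ḣ^{1/2} ⊂ L³`), which
may be taken real and weakly divergence free (`HomSobolev.Represents.exists_real_divFree`); by
Cor. 4.2 (`rusin_sverak_weak_limit_of_singular_points` with `T = 1`, `x_k = 0`) it has no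
global Kato solution. General viscosity by `rusin_sverak_weak_limit_blowup_iff_unit_viscosity`.
[cite: RusinSverak2011, proof of Cor. 4.3 (arXiv:0911.0500 p. 8) with Cor. 4.2 and §4 p. 6] -/
theorem rusin_sverak_weak_limit_blowup_of_singular_points
    (hN : rusin_sverak_singular_point_of_blowup) (hC : rusin_sverak_weak_limit_of_singular_points)
    (hS : FunctionSpaces.eLpNorm_three_le_eHomSobolevSeminorm_half.{0}) : rusin_sverak_weak_limit_blowup := by
  rw [rusin_sverak_weak_limit_blowup_iff_unit_viscosity]
  intro u₀ g hdata hR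
  -- sentence 2: normalisation of each blow-up datum
  choose T hT xs u hmild hcont h0 hmeas hsing using fun k =>
    hN (u₀ k) (g k) (hdata k).1 (hdata k).2.1 (hdata k).2.2.1 (hdata k).2.2.2
  refine ⟨fun k => Real.sqrt (T k), fun k => -xs k, fun k => Real.sqrt_pos.2 (hT k), ?_⟩
  intro g' hg' φ hφ glim hweak
  have hnorm := fun k =>
    kato_local_normalise (ν := 1) (hT k) (hmild k) (hcont k) (h0 k) (hmeas k) (xs k) (hsing k)
  -- the normalised classes have the norms of the original ones
  obtain ⟨R, hR⟩ := hR
  have hg'norm : ∀ k, ‖g' k‖ ≤ R := fun k => by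
    obtain ⟨g'', hg''rep, hg''norm⟩ := exists_represents_rescaleData_norm_eq (u₀ k) (g k)
      (Real.sqrt_pos.2 (hT k)) (-xs k) (hdata k).2.1
    rw [(hg' k).unique hg''rep, hg''norm]
    exact hR k
  -- the normalised data are weakly divergence-free `L³` fields
  have hmod : ∀ k, MemLp (FluidPDE.rescaleData (Real.sqrt (T k)) fun x => u₀ k (x - -xs k)) 3 volume ∧
      FluidPDE.IsWeaklyDivFree (FluidPDE.rescaleData (Real.sqrt (T k)) fun x => u₀ k (x - -xs k)) :=
    fun k =>
    ⟨memLp_three_rescaleData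
      ((hdata k).1.comp_measurePreserving (measurePreserving_sub_right volume (-xs k)))
      (Real.sqrt_pos.2 (hT k)),
     ((hdata k).2.2.1.comp_sub_right (-xs k)).nsRescaleData (Real.sqrt_pos.2 (hT k))⟩
  -- sentence 3: the weak limit is an `L³`, real, divergence-free datum
  obtain ⟨f, hf3, hfrep⟩ := FunctionSpaces.HomSobolev.exists_represents_memLp_three hS glim
  obtain ⟨vlim, hv3, hvrep, hvdiv, -⟩ := FunctionSpaces.HomSobolev.Represents.exists_real_divFree hweak
    (u := fun n => FluidPDE.rescaleData (Real.sqrt (T (φ n))) fun x => u₀ (φ n) (x - -xs (φ n)))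
    (fun n => hg' (φ n)) (fun n => (hmod (φ n)).1.locallyIntegrable (by norm_num))
    (fun n => (hmod (φ n)).2) hfrep hf3
  refine ⟨vlim, hv3, hvrep, hvdiv, ?_⟩
  -- sentence 4: Cor. 4.2 with `T = 1`, singular points `(1, 0)`
  exact hC 1 one_pos (fun n => FluidPDE.rescaleData (Real.sqrt (T (φ n))) fun x => u₀ (φ n) (x - -xs (φ n)))
    (fun n => g' (φ n))
    (fun n => fun t x => Real.sqrt (T (φ n)) • u (φ n) (Real.sqrt (T (φ n)) ^ 2 * t)
      (Real.sqrt (T (φ n)) • x - -xs (φ n)))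
    (fun _ => 0)
    (fun n => ⟨(hmod (φ n)).1, hg' (φ n), (hmod (φ n)).2⟩) ⟨R, fun n => hg'norm (φ n)⟩
    (fun n => ⟨(hnorm (φ n)).1, (hnorm (φ n)).2.1, (hnorm (φ n)).2.2.1, (hnorm (φ n)).2.2.2.1⟩)
    (fun n r hr => (hnorm (φ n)).2.2.2.2 r hr) ⟨0, fun n => by simp⟩ glim hweak vlim hv3 hvrep hvdiv

/-- **Rusin–Šverák, Cor. 4.3, second clause (`rusin_sverak_minimal_data_compact`) from the two
PDE facts and the Sobolev embedding**: `rusin_sverak_minimal_data_compact_of_weak_limit_blowup`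
composed with `rusin_sverak_weak_limit_blowup_of_singular_points`.
[cite: RusinSverak2011, Cor. 4.3 (arXiv:0911.0500 p. 8)] -/
theorem rusin_sverak_minimal_data_compact_of_singular_points
    (hN : rusin_sverak_singular_point_of_blowup) (hC : rusin_sverak_weak_limit_of_singular_points)
    (hS : FunctionSpaces.eLpNorm_three_le_eHomSobolevSeminorm_half.{0}) : rusin_sverak_minimal_data_compact :=
  rusin_sverak_minimal_data_compact_of_weak_limit_blowup
    (rusin_sverak_weak_limit_blowup_of_singular_points hN hC hS)

/-- **Rusin–Šverák, Cor. 4.3, first clause (`rusin_sverak_minimal_blowup`, `MildSolutions.lean`,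
ns.S14) from the two PDE facts and the Sobolev embedding**:
`rusin_sverak_minimal_blowup_of_weak_limit_blowup` composed with
`rusin_sverak_weak_limit_blowup_of_singular_points`.
[cite: RusinSverak2011, Cor. 4.3 (arXiv:0911.0500 p. 8)] -/
theorem rusin_sverak_minimal_blowup_of_singular_points
    (hN : rusin_sverak_singular_point_of_blowup) (hC : rusin_sverak_weak_limit_of_singular_points)
    (hS : FunctionSpaces.eLpNorm_three_le_eHomSobolevSeminorm_half.{0}) : rusin_sverak_minimal_blowup :=
  rusin_sverak_minimal_blowup_of_weak_limit_blowup
    (rusin_sverak_weak_limit_blowup_of_singular_points hN hC hS)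

end Literature.Analysis.FluidPDE
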